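import Summits.ABC.IUTFork.Cor312Chain
import HarnessLib

/-!
# [IUTchIII] Cor. 3.12, Steps (xi-f)–(xii) as kernel inferences — the disputed node's inference, explicit

Record-only file (D-0012) of the abc-iut cell (Cor. 3.12 STRATEGY TEAM A «direct III§3», D-0067, seat
abc-iut-c312-9 = A1, row A-4 of `HOME/plan/C312-TEAMS.md`); TAKES NO SIDE; proof-only. Team A types each
printed inference of the proof of Cor. 3.12 (kurims `paper:url-4b091feeb646` pp. 174–186) as a kernel lemma
over the frozen definitions. This file does the FINAL FOUR nodes, under an ARBITRARY reading `O` of the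
proof's observations (the team's honest readings plug in at assembly; c312-10's `Cor312StepXReal` does
Step (x), c312-4's `Cor312StepXIdeReal` does (xi-d)/(xi-e)):

* `xi_f_holds_iff` — **the disputed node (xi-f) (p. 184 l. 19–29), as an inference, is EXACTLY the
  implication "(xi-e)'s display ∧ (SHE)-as-fixed-value ⟹ constitutes-a-construction"**: its citation list is
  EMPTY (`Step.xi_f_data`), so `Step.xi_f.Holds L O` holds for NO reason of the loci — whatever discharges it
  must come from the reading of the three observations. This is the chain-level form of the team's GAP
  statement: granting the (xi-e) observations, (xi-f) holds iff `O .constitutesConstruction` is granted — and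
  `Cor312Chain.RealEdges.inclusion` then turns that observation into the inequality.
* `xi_g_holds_iff` — (xi-g) (p. 184 l. 30–34, Fig. 3.8 "two tautologically equivalent ways"): the inference is
  exactly "`thm3_11_algo` ∧ constitutes ⟹ two-equivalent-ways".
* `xi_h_holds_of_nthPower` / `xi_h_holds` — (xi-h) (p. 185 l. 48–58): the no-`N`-th-power observation; the
  kernel content at this level is the landed `nthPower_not_formal` (the `N = 2` analogue is NOT formal), so
  the node holds outright under any reading granting that landed fact.
* `xii_holds_of` — (xii) (p. 185 l. 59 – p. 186 l. 3): terminal narrative node (why global realified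
  Frobenioids are needed); `concl_unique` shows nothing downstream invokes its observation — a reading grants
  it directly (no-inflation rule: no content is smuggled).
* `tail_holds_of_gap` — the four nodes hold simultaneously once the single (xi-f) implication (the GAP form)
  and the two terminal observations are granted: the tail of the chain reduces to ONE implication.

[claim: Mochizuki2012, status: disputed] Deliberately NOT here: any claim that the (xi-f) implication HOLDS
for an instantiated setting (that is the team's GAP question, `Cor312TeamAGapWitness`/`Cor312ReadingIso`);
the honest readings themselves (assembly file, after A-0…A-3 land); any judgement.
-/

namespace Summit.ABC

namespace IUTFork

namespace Cor312Proof

open Locus Obs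

variable {L : Locus → Prop} {O : Obs → Prop}

/-! ## 1. (xi-f): the inference IS the implication -/

/-- **Step (xi-f) as an inference, solved for its content** (p. 184 l. 19–29; THE DISPUTED NODE): since
(xi-f) cites NO locus (`Step.xi_f_data`), `Step.xi_f.Holds L O` is, for every reading of every locus,
exactly the implication "(xi-e)'s two observations ⟹ `constitutesConstruction`". The team's GAP statement is
this implication under the honest readings. [claim: Mochizuki2012, status: disputed] -/
theorem xi_f_holds_iff :
    Step.xi_f.Holds L O ↔ (O .displayXIe → O .sheMeansFixedValue → O .constitutesConstruction) := by
  constructor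
  · intro h h1 h2
    refine h (fun c hc => by simp [Step.cites, Step.data] at hc) (fun o ho => ?_)
      .constitutesConstruction (by decide)
    have ho' : o = Obs.displayXIe ∨ o = Obs.sheMeansFixedValue := by
      simpa [Step.uses, Step.data] using ho
    rcases ho' with rfl | rfl
    · exact h1
    · exact h2
  · intro h _ hu o ho
    have ho' : o = Obs.constitutesConstruction := by
      simpa [Step.concl, Step.data] using ho
    subst ho'
    exact h (hu .displayXIe (by decide)) (hu .sheMeansFixedValue (by decide))

/-- (xi-f) holds the moment the reading grants its conclusion — the degenerate discharge, recorded to show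
what does NOT count: granting `constitutesConstruction` outright begs the disputed content. [folklore] -/
theorem xi_f_holds_of_constitutes (h : O .constitutesConstruction) : Step.xi_f.Holds L O :=
  xi_f_holds_iff.2 fun _ _ => h

/-! ## 2. (xi-g): the inference solved for its content -/

/-- **Step (xi-g) as an inference, solved for its content** (p. 184 l. 30–34): exactly "the Thm-3.11
algorithm locus ∧ `constitutesConstruction` ⟹ `twoEquivalentWays`". [claim: Mochizuki2012, status: disputed] -/
theorem xi_g_holds_iff :
    Step.xi_g.Holds L O ↔ (L .thm3_11_algo → O .constitutesConstruction → O .twoEquivalentWays) := by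
  constructor
  · intro h h1 h2
    refine h (fun c hc => ?_) (fun o ho => ?_) .twoEquivalentWays (by decide)
    · have hc' : c = Locus.thm3_11_algo := by simpa [Step.cites, Step.data] using hc
      subst hc'; exact h1
    · have ho' : o = Obs.constitutesConstruction := by simpa [Step.uses, Step.data] using ho
      subst ho'; exact h2
  · intro h hc hu o ho
    have ho' : o = Obs.twoEquivalentWays := by simpa [Step.concl, Step.data] using ho
    subst ho'
    exact h (hc .thm3_11_algo (by decide)) (hu .constitutesConstruction (by decide))

/-! ## 3. (xi-h), (xii): terminal nodes -/

/-- Step (xi-h) holds under any reading granting its (terminal, never-invoked) observation. [folklore] -/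
theorem xi_h_holds_of (h : O .noNthPower) : Step.xi_h.Holds L O := by
  intro _ _ o ho
  have ho' : o = Obs.noNthPower := by simpa [Step.concl, Step.data] using ho
  subst ho'; exact h

/-- The kernel content available for (xi-h)'s observation at this level: the landed `nthPower_not_formal`
(the `N = 2` analogue `−|log(q)| ≤ 2·(−|log(Θ)|)` does not follow formally; p. 185 l. 58, [IUTchIV]
Rmk. 2.3.2 (ii)) — so a reading may set `O .noNthPower` to this fact and (xi-h) holds outright. [folklore] -/
theorem xi_h_holds_nthPower
    (h : O .noNthPower ↔ ∃ V : Volumes, V.Cor312 ∧ V.negLogTheta = ((-1 : ℝ) : WithTop ℝ) ∧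
      ¬ (V.negAbsLogq ≤ 2 * (-1))) : Step.xi_h.Holds L O :=
  xi_h_holds_of (h.2 nthPower_not_formal)

/-- Step (xii) holds under any reading granting its (terminal, never-invoked) observation: a narrative node
(why global realified Frobenioids are needed, Rmk. 3.6.2 (i)); `Step.concl_unique` shows no other node
invokes `globalFrobenioidsNeeded`, so granting it smuggles nothing (no-inflation rule). [folklore] -/
theorem xii_holds_of (h : O .globalFrobenioidsNeeded) : Step.xii.Holds L O := by
  intro _ _ o ho
  have ho' : o = Obs.globalFrobenioidsNeeded := by simpa [Step.concl, Step.data] using ho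
  subst ho'; exact h

/-! ## 4. The tail of the chain reduces to the one implication -/

/-- **The tail (xi-f), (xi-g), (xi-h), (xii) of the twenty-node chain holds once the single (xi-f)
implication — the GAP form — and the two terminal observations are granted.** What remains of the printed
proof's tail, beyond bookkeeping, is exactly the hypothesis `hgap`.
[claim: Mochizuki2012, status: disputed] -/
theorem tail_holds_of_gap
    (hgap : O .displayXIe → O .sheMeansFixedValue → O .constitutesConstruction)
    (hg : L .thm3_11_algo → O .constitutesConstruction → O .twoEquivalentWays)
    (hh : O .noNthPower) (hx : O .globalFrobenioidsNeeded) :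
    Step.xi_f.Holds L O ∧ Step.xi_g.Holds L O ∧ Step.xi_h.Holds L O ∧ Step.xii.Holds L O :=
  ⟨xi_f_holds_iff.2 hgap, xi_g_holds_iff.2 hg, xi_h_holds_of hh, xii_holds_of hx⟩

end Cor312Proof

end IUTFork

end Summit.ABC
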